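/-
Copyright (c) 2026 the pub-hodgecm-mathlib formalisation cell (harness21).  Prover seat hodgecm-mathlib-F0P2-p09 (g3) on chair-VALVE loan to section S6 of the R90-TF
programme (S6 dealer R90-C14-plan (g2) CARD (m2), 2026-09-05T02:24:21Z; chair K2-lead (g2) VALVE 19); crux H413 (`stmt-HodgeConjecture-24833`).
THEOREMS ONLY (no `def`, no `instance`, no notation, no named-fact hypothesis, no `sorry`).
-/
import Literature.NumberTheory.Rogawski1990.UnitFundamentalLemmaInertFlickerTorus   -- ★ Flicker's literals `t_θ(a,b,c)`: `charpoly_flickerTorusElt`, `flickerTorusElt_unitary`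
import Mathlib.Topology.Algebra.Valued.ValuedField
import HarnessLib

/-!
# R90 · S6 — CARD (m2): REGIME CLASSIFICATION OF THE FOUR FLICKER LITERALS `t₁ = t_1(a,b,c)`, `t₂ = t_ϖ(a,b,c)`, `t₃ = t_ϖ(a,c,b)`, `t₄ = t_ϖ(b,a,c)`
# (`Theorems/R90S6FlickerLiteralRegimes.lean`)

Cell `hodgecm-mathlib`, crux H413 (`stmt-HodgeConjecture-24833`), route of record `HCCMUnconditional`; programme R90-TF, section S6 (base `R90-C14`); S6 dealer
R90-C14-plan (g2) CARD (m2) 02:24:21Z; consumer GF1 FILE 2 (K2Liu-p14 (g5)); helper lane `--supports stmt-HodgeConjecture-24833 --as helper`.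

THE FOUR LITERALS of typ1 (g3)'s (E1) sheet v1.1 (`S6_E1352_elliptic_identity_targets`, binders `hγ₁ … hγ₄`) are Flicker's ring-generic matrices
`t_θ(x,y,z) = !![e(x+z), 0, −e(x−z)θ; 0, y, 0; −e(x−z)θ', 0, e(x+z)]` (`2e = 1`, `θθ' = 1`; `θ = 1` for `t₁`, `θ = ϖ` for `t₂, t₃, t₄`) at the eigenvalue triples
`(a,b,c), (a,b,c), (a,c,b), (b,a,c)`, `a, b, c` norm-one (`σa·a = 1`) and pairwise distinct.  By ★ `charpoly_flickerTorusElt` ALL FOUR have characteristic polynomial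
`(X − a)(X − b)(X − c)`; the REGIME LETTERS of the ★ G1 rungs are intrinsic (functions of `charpoly γ` and of residual data of the eigenvalues), so the regime of a literal is a
function of the DEPTHS `n_ab = v(a − b)`, `n_ac`, `n_bc` alone, the same for the four literals (the literal-dependent datum — which eigenline is odd, i.e. the κ-sign — lives in the
frame ∕ Fix currency, not in the regime).  The rung letters, VERBATIM: R-III ★ `natCard_fixedBy_special_add_eq_one_of_residually_separated` (`R90S6TorusFixedSpecialCountResiduallySeparated`
:253–:256) `(α : Fin 3 → K) (hαn : ∀ l, α l * σ (α l) = 1) (hsep : ∀ l m, l ≠ m → Valued.v (α l - α m) = 1) (hχ : ∀ i, Valued.v ((charpoly γ - ∏ l : Fin 3, (X - C (α l))).coeff i) < 1)`;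
R-II ★ `natCard_fixedBy_special_eq_one_add_mul_of_charpoly_two_congruent` (`…TwoCongruentIntrinsic` :218–:220) `(hc₁ : Valued.v c₁ = 1) (hsep : Valued.v (c₁ - c₂) = 1)
(hu₁ : Valued.v (σ c₁ * c₁ - 1) < 1) (hu₂ : …) (hχ : ∀ i, Valued.v ((charpoly γ - (X - C c₁) ^ 2 * (X - C c₂)).coeff i) < 1)`; R-I ★ `natCard_fixedBy_special_eq_one_add_mul_of_residually_unipotent`
(`…Unipotent` :125–:127) `(hc : Valued.v c = 1) (hχ : ∀ i, Valued.v ((charpoly γ - (X - C c) ^ 3).coeff i) < 1)`; type (2) ★ `natCard_fixedBy_special_add_phiTHn_eq_of_typeTwo`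
(`…ClosedForm` :99–:103) `(hN : Valued.v ((tr γ - u) ^ 2 - 4 * (det γ / u)) = Valued.v (ϖ ^ (2 * N + 1)))`.
* §1 polynomial bookkeeping: products of polynomials with integral coefficients have integral coefficients; `X − C a` has integral coefficients for `|a| ≤ 1`.
* §2 THE REGIMES, for any matrix `M` with `M.charpoly = (X − C a)(X − C b)(X − C c)` (each literal by ★ `charpoly_flickerTorusElt` and a `mul_comm`):
  **`flickerLiteral_charpoly_letter_separated`** — R-III's `hχ` at `α := ![a, b, c]` holds outright (difference `0`); `flickerLiteral_separated_letters_iff` — R-III's `hsep` at `![a,b,c]` ⟺ `n_ab = n_ac = n_bc = 0`;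
  `flickerLiteral_normOne_letters` — R-III's `hαn`; **`flickerLiteral_charpoly_letter_two_congruent`** — `n_ab ≥ 1` (`|a − b| < 1`) ⟹ R-II's `hχ` at `(c₁, c₂) := (a, c)` (difference `(a − b)·(X − a)(X − c)`),
  whose `hsep` IS `n_ac = 0` and whose `hu₁ hu₂` are `flickerLiteral_norm_one_letters`; **`flickerLiteral_charpoly_letter_unipotent`** — `n_ab, n_ac ≥ 1` ⟹ R-I's `hχ` at `c := a`; `flickerLiteral_v_sub_lt_one_trans` — the
  ultrametric trichotomy (0, 1 or 3 residually congruent pairs, never 2), so the three regimes EXHAUST the depth data; **`flickerLiteral_discr_ne_of_ne`** — the type-(2) letter `hN` NEVER holds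
  for an `E¹`-type literal (`u := b`: `(tr − b)² − 4·det∕b = (a − c)²` has even valuation).
[Rogawski1990, §3.9 p. 32, §4.9 pp. 54–56] [Flicker1998UnitaryFL, §2 Prop. 3 pp. 78–79] [Kottwitz1986BaseChangeUnits, §1 pp. 240–242] [Serre1980Trees, I.6.4].
HONEST LABEL: regime bookkeeping only, pays no rung and no printed statement; count-neutral.  HC_CM is proved only modulo the 7 printed citations (2 remaining named inputs:
hLiu418 = `stmt-HodgeConjecture-24832`, h413 = `stmt-HodgeConjecture-24833`) until rung 0 closes.

## References
* [Rogawski1990] J. D. Rogawski, *Automorphic Representations of Unitary Groups in Three Variables*, Ann. of Math. Stud. 123 (1990): §3.9 p. 32, §4.9 Prop. 4.9.1, Lemma 4.9.3 pp. 54–56.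
* [Flicker1998UnitaryFL] Y. Z. Flicker, *Elementary proof of the fundamental lemma for a unitary group*, Canad. J. Math. 50 (1998) 74–98: §2 Prop. 3 pp. 78–79 (`t₁…t₄`), §3 p. 80 (`t_θ`).
* [Kottwitz1986BaseChangeUnits] R. E. Kottwitz, *Base change for unit elements of Hecke algebras*, Compositio Math. 60 (1986) 237–250: §1 pp. 240–242 (regimes by residual eigenvalue data).
* [Serre1980Trees] J.-P. Serre, *Trees* (1980): I.6.4 Prop. 24–25.
-/

set_option autoImplicit false
-- the mandated namespace repeats the single-problem summit's segment (`HodgeConjecture.HodgeConjecture`)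
set_option linter.dupNamespace false

noncomputable section

open Polynomial
open scoped WithZero Valued

namespace Summit.HodgeConjecture.HodgeConjecture.R90.S6

variable {K : Type*} [Field K] [Valued K ℤᵐ⁰]

/-! ## §1 Polynomial bookkeeping: integral coefficients -/

/-- the coefficients of `X − C a` are integral for `|a| ≤ 1`. [cite: Serre1980Trees, I.6.4] -/
theorem flickerLiteral_v_coeff_X_sub_C_le_one {a : K} (ha : Valued.v a ≤ 1) (i : ℕ) : Valued.v ((X - C a : K[X]).coeff i) ≤ 1 := by
  rw [coeff_sub, coeff_X, coeff_C]
  split_ifs with h1 h2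
  · exfalso; omega
  · rw [sub_zero, map_one]
  · rw [zero_sub, Valuation.map_neg]; exact ha
  · rw [sub_zero, map_zero]; exact zero_le_one

/-- products of polynomials with integral coefficients have integral coefficients (ultrametric inequality on `coeff_mul`). [cite: Serre1980Trees, I.6.4] -/
theorem flickerLiteral_v_coeff_mul_le_one {p q : K[X]} (hp : ∀ i, Valued.v (p.coeff i) ≤ 1) (hq : ∀ i, Valued.v (q.coeff i) ≤ 1) (i : ℕ) :
    Valued.v ((p * q).coeff i) ≤ 1 := by
  rw [coeff_mul]
  refine Valuation.map_sum_le _ fun x _ => ?_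
  rw [map_mul]
  exact mul_le_one' (hp _) (hq _)

/-- `|k| < 1` and `p` integral ⟹ every coefficient of `C k · p` has valuation `< 1`. [cite: Serre1980Trees, I.6.4] -/
theorem flickerLiteral_v_coeff_C_mul_lt_one {k : K} (hk : Valued.v k < 1) {p : K[X]} (hp : ∀ i, Valued.v (p.coeff i) ≤ 1) (i : ℕ) :
    Valued.v ((C k * p).coeff i) < 1 := by
  rw [coeff_C_mul, map_mul]
  calc Valued.v k * Valued.v (p.coeff i) ≤ Valued.v k * 1 := mul_le_mul' le_rfl (hp i)
    _ < 1 := by rw [mul_one]; exact hk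

/-! ## §2 The regimes of an element with characteristic polynomial `(X − a)(X − b)(X − c)` — all four Flicker literals (★ `charpoly_flickerTorusElt`) -/

/-- **R-III's `hχ`-LETTER HOLDS OUTRIGHT at `α := ![a, b, c]`** for any `M` with `χ_M = (X − a)(X − b)(X − c)` (the difference is `0`). [cite: Rogawski1990, §3.9 p. 32] -/
theorem flickerLiteral_charpoly_letter_separated {M : Matrix (Fin 3) (Fin 3) K} {a b c : K} (hM : M.charpoly = (X - C a) * (X - C b) * (X - C c)) (i : ℕ) :
    Valued.v ((M.charpoly - ∏ l : Fin 3, (X - C (![a, b, c] l))).coeff i) < 1 := by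
  have h : (∏ l : Fin 3, (X - C (![a, b, c] l)) : K[X]) = (X - C a) * (X - C b) * (X - C c) := by
    rw [Fin.prod_univ_three]
    rfl
  rw [h, hM, sub_self, coeff_zero, map_zero]
  exact zero_lt_one

/-- **R-III's `hsep`-LETTER at `![a, b, c]` ⟺ ALL THREE DEPTHS VANISH** (`n_ab = n_ac = n_bc = 0`, i.e. `|a − b| = |a − c| = |b − c| = 1`). [cite: Kottwitz1986BaseChangeUnits, §1 pp. 240–242] -/
theorem flickerLiteral_separated_letters_iff (a b c : K) :
    (∀ l m : Fin 3, l ≠ m → Valued.v (![a, b, c] l - ![a, b, c] m) = 1) ↔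
      Valued.v (a - b) = 1 ∧ Valued.v (a - c) = 1 ∧ Valued.v (b - c) = 1 := by
  constructor
  · intro h
    exact ⟨h 0 1 (by decide), h 0 2 (by decide), h 1 2 (by decide)⟩
  · rintro ⟨hab, hac, hbc⟩ l m hlm
    have hba : Valued.v (b - a) = 1 := by rw [Valuation.map_sub_swap]; exact hab
    have hca : Valued.v (c - a) = 1 := by rw [Valuation.map_sub_swap]; exact hac
    have hcb : Valued.v (c - b) = 1 := by rw [Valuation.map_sub_swap]; exact hbc
    fin_cases l <;> fin_cases m
    all_goals first | exact absurd rfl hlm | exact hab | exact hac | exact hbc | exact hba | exact hca | exact hcb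

omit [Valued K ℤᵐ⁰] in
/-- **R-III's `hαn`-LETTER** from the sheet's norm-one letters `σa·a = σb·b = σc·c = 1`. [cite: Rogawski1990, §4.9 p. 55] -/
theorem flickerLiteral_normOne_letters (σ : K →+* K) {a b c : K} (ha : σ a * a = 1) (hb : σ b * b = 1) (hc : σ c * c = 1) :
    ∀ l : Fin 3, ![a, b, c] l * σ (![a, b, c] l) = 1 := by
  intro l
  fin_cases l
  · show a * σ a = 1; rw [mul_comm]; exact ha
  · show b * σ b = 1; rw [mul_comm]; exact hb
  · show c * σ c = 1; rw [mul_comm]; exact hc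

/-- **R-II's ∕ R-I's side letters from norm one**: `σa·a = 1 ⟹ |σa·a − 1| = 0 < 1` (the `hu₁`, `hu₂` letters) and, `σ` being an isometry (`hσv`, e.g. ★
`UnramifiedLocalConjDatum.vσ`), `|a|² = 1`, whence `|a| = 1` in the linearly ordered value group (the `hc₁`, `hc` letters). [cite: Rogawski1990, §4.9 p. 55] -/
theorem flickerLiteral_norm_one_letters (σ : K →+* K) (hσv : ∀ x, Valued.v (σ x) = Valued.v x) {a : K} (ha : σ a * a = 1) :
    Valued.v (σ a * a - 1) < 1 ∧ Valued.v a = 1 := by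
  refine ⟨by rw [ha, sub_self, map_zero]; exact zero_lt_one, ?_⟩
  have h := congrArg Valued.v ha
  rw [map_mul, map_one, hσv] at h
  -- `|a|² = 1` in the linearly ordered `ℤᵐ⁰` forces `|a| = 1`
  rcases lt_trichotomy (Valued.v a) 1 with hlt | heq | hgt
  · exfalso
    have : Valued.v a * Valued.v a < 1 := mul_lt_one' hlt hlt
    rw [h] at this; exact lt_irrefl _ this
  · exact heq
  · exfalso
    have : 1 < Valued.v a * Valued.v a := one_lt_mul'' hgt hgt
    rw [h] at this; exact lt_irrefl _ this

/-- **`n_ab ≥ 1` ⟹ R-II's `hχ`-LETTER at `(c₁, c₂) := (a, c)`**: for `χ_M = (X − a)(X − b)(X − c)` with `|a|, |c| ≤ 1` and `|a − b| < 1`,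
`χ_M − (X − a)²(X − c) = (a − b)·(X − a)(X − c)` has all coefficients of valuation `< 1`.  (R-II then needs `hsep : |a − c| = 1`, i.e. `n_ac = 0`; the pairings
`(b ≡ c)` and `(a ≡ c)` are this lemma after relabelling the triple — `χ_M` is symmetric in `a, b, c`.) [cite: Kottwitz1986BaseChangeUnits, §1 pp. 240–242] [cite: Rogawski1990, §4.9 Lemma 4.9.3] -/
theorem flickerLiteral_charpoly_letter_two_congruent {M : Matrix (Fin 3) (Fin 3) K} {a b c : K} (hM : M.charpoly = (X - C a) * (X - C b) * (X - C c))
    (ha1 : Valued.v a ≤ 1) (hc1 : Valued.v c ≤ 1) (hab : Valued.v (a - b) < 1) (i : ℕ) :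
    Valued.v ((M.charpoly - (X - C a) ^ 2 * (X - C c)).coeff i) < 1 := by
  have h : M.charpoly - (X - C a) ^ 2 * (X - C c) = C (a - b) * ((X - C a) * (X - C c)) := by
    rw [hM, map_sub]; ring
  rw [h]
  exact flickerLiteral_v_coeff_C_mul_lt_one hab (flickerLiteral_v_coeff_mul_le_one (flickerLiteral_v_coeff_X_sub_C_le_one ha1) (flickerLiteral_v_coeff_X_sub_C_le_one hc1)) i

/-- **`n_ab, n_ac ≥ 1` ⟹ R-I's `hχ`-LETTER at `c := a`**: for `χ_M = (X − a)(X − b)(X − c)` with `|a|, |c| ≤ 1`, `|a − b| < 1`, `|a − c| < 1`,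
`χ_M − (X − a)³ = (a − b)·(X − a)(X − c) + (a − c)·(X − a)²` has all coefficients of valuation `< 1` (ultrametric). [cite: Kottwitz1986BaseChangeUnits, §1 pp. 240–242] -/
theorem flickerLiteral_charpoly_letter_unipotent {M : Matrix (Fin 3) (Fin 3) K} {a b c : K} (hM : M.charpoly = (X - C a) * (X - C b) * (X - C c))
    (ha1 : Valued.v a ≤ 1) (hc1 : Valued.v c ≤ 1) (hab : Valued.v (a - b) < 1) (hac : Valued.v (a - c) < 1) (i : ℕ) :
    Valued.v ((M.charpoly - (X - C a) ^ 3).coeff i) < 1 := by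
  have h : M.charpoly - (X - C a) ^ 3 = C (a - b) * ((X - C a) * (X - C c)) + C (a - c) * ((X - C a) * (X - C a)) := by
    rw [hM, map_sub, map_sub]; ring
  rw [h, coeff_add]
  exact Valuation.map_add_lt _
    (flickerLiteral_v_coeff_C_mul_lt_one hab (flickerLiteral_v_coeff_mul_le_one (flickerLiteral_v_coeff_X_sub_C_le_one ha1) (flickerLiteral_v_coeff_X_sub_C_le_one hc1)) i)
    (flickerLiteral_v_coeff_C_mul_lt_one hac (flickerLiteral_v_coeff_mul_le_one (flickerLiteral_v_coeff_X_sub_C_le_one ha1) (flickerLiteral_v_coeff_X_sub_C_le_one ha1)) i)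

/-- **THE TRICHOTOMY**: two residually congruent pairs force the third (`a − c = (a − b) + (b − c)`, ultrametric) — so among the three depths either none, exactly one, or all
three are positive: R-III ∕ R-II ∕ R-I exhaust the depth data of a norm-one triple. [cite: Serre1980Trees, I.6.4] -/
theorem flickerLiteral_v_sub_lt_one_trans {a b c : K} (hab : Valued.v (a - b) < 1) (hbc : Valued.v (b - c) < 1) : Valued.v (a - c) < 1 := by
  have h : a - c = (a - b) + (b - c) := by ring
  rw [h]
  exact Valuation.map_add_lt _ hab hbc

/-- **THE `E¹`-TYPE LITERALS ARE NEVER OF TYPE (2)**: for the literal `t_θ(a,b,c)` with `u := b` on the anisotropic middle line one has `tr − u = a + c`, `det ∕ u = ac`, and the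
type-(2) letter `hN : |(tr − u)² − 4·(det∕u)| = |ϖ^{2N+1}|` of ★ `…ClosedForm` fails: `(a + c)² − 4ac = (a − c)²` has EVEN valuation while `|ϖ^{2N+1}| = exp(−(2N+1))`.
[cite: Rogawski1990, §3.9 p. 32] -/
theorem flickerLiteral_discr_ne_of_ne {ϖ : K} (hϖ : Valued.v ϖ = WithZero.exp (-1 : ℤ)) {a c : K} (hac : a ≠ c) (N : ℕ) :
    Valued.v ((a + c) ^ 2 - 4 * (a * c)) ≠ Valued.v (ϖ ^ (2 * N + 1)) := by
  have h : (a + c) ^ 2 - 4 * (a * c) = (a - c) ^ 2 := by ring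
  rw [h, map_pow, map_pow, hϖ, ← WithZero.exp_nsmul, nsmul_eq_mul, mul_neg, mul_one]
  have hne : Valued.v (a - c) ≠ 0 := (Valuation.ne_zero_iff _).2 (sub_ne_zero.2 hac)
  rw [← WithZero.exp_log hne, ← WithZero.exp_nsmul, WithZero.exp_inj.ne, nsmul_eq_mul]
  push_cast
  omega

end Summit.HodgeConjecture.HodgeConjecture.R90.S6

end
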